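import Literature.Geometry.Riemannian.GurskyViaclovskyLinearisation
import Literature.Geometry.Riemannian.GurskyViaclovskyClosednessBootstrapAux
import Literature.Geometry.Riemannian.GurskyViaclovskyChartEquationC2
import Literature.Analysis.PDE.EllipticSmoothBootstrapStep
import HarnessLib

/-!
# Gursky–Viaclovsky 2003, Prop. 2: the linearised path operator in a chart

Support file (everything PROVED; no definition, no named fact) for the openness half of the
Gursky–Viaclovsky continuity method (`Literature.Geometry.Riemannian.gurskyViaclovsky_pathOpen_weighted_four`,
Gursky–Viaclovsky, J. Differential Geom. 63 (2003), Prop. 2 and §5). The surjectivity of the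
linearisation `𝓛_{t,w} + 4q e^{−4w}` of `w ↦ F_t(w) − q e^{−4w}` (`F_t = backgroundPathOperator g t`,
`𝓛 = linearisedBackgroundOperator`, `GurskyViaclovskyLinearisation.lean`) in `C^{2,α}(M)` is
Schauder theory (Gilbarg–Trudinger 2001, Thm. 6.2 patched over charts, the tree's
`Literature.Analysis.FunctionSpaces.exists_schauder_global`), which wants the operator written in
every chart as `Σ a^{ij} D_{ij} + Σ bⁱ D_i + c` with symmetric, uniformly elliptic, Hölder
coefficients. This file produces these chart coefficients at a SMOOTH admissible solution `w`
(`backgroundPathOperator g t w = q e^{−4w}`, `backgroundScalar g w > 0`, `t ≤ 1`):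

* `clm_apply_cjet_two` — a linear functional of a coordinate `2`-jet expanded over the three
  slots (pure linear algebra on `CJet ι 2`);
* `exists_linearised_chartRep` — in the preferred chart at `c`, with `x = (chartAt c)⁻¹ y`,
  `û = u ∘ (chartAt c)⁻¹`:
  `−(𝓛_{t,w}u(x) + 4q(x)e^{−4w(x)}u(x)) = Σ a^{ii'}(y) D²û(y)(e_i, e_{i'}) + Σ bˡ(y) Dû(y)(e_l) + c(y) û(y)`
  for every `u ∈ C²(M)`, with `a, b, c` smooth on the chart target, `a` symmetric and POSITIVE
  DEFINITE at every point of the target. Proof: along the line `s ↦ w + su` the chart equation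
  (`backgroundPathOperator_chart_eq_chartOperator_of_contMDiffAt_two`, the `C²` version) reads
  `F_t(w + su)(x) − q e^{−4(w+su)(x)} = G(y, t, cjet₂(−ŵ − sû)(y))` with the closedness programme's
  smooth jet function `G` (`contDiffOn_jetOperator`); differentiating at `s = 0`
  (`hasDerivAt_backgroundPathOperator`, the chain rule, `HasDerivAt.unique`) gives
  `−(𝓛u + 4qe^{−4w}u)(x) = ∂_J G(y, t, cjet₂(−ŵ)(y)) · cjet₂û(y)`, which is expanded over the jet
  slots (`clm_apply_cjet_two`; top slot through the symmetrised symbol `symCoef`,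
  `sum_symCoef_mul`). Positivity of `(a^{ii'})` is the uniform ellipticity of the jet function
  along an admissible solution (`le_fderiv_jetOperator_single`, Gursky–Viaclovsky Prop. 1 (ii) read
  through the frame; all its constants are evaluated at the point) converted by `symCoef_lower`.

What is NOT here: the Hölder chart data, cutoffs and the global Schauder estimate (the assembly on
`C^{2,α}_𝔄(M)` lives with its consumer); invertibility of the linearisation.

## References

* M. J. Gursky, J. A. Viaclovsky, J. Differential Geom. 63 (2003) 131–154, §2 (Prop. 1 (ii),
  Prop. 2 and its proof), §5. [GurskyViaclovsky2003]
* D. Gilbarg, N. S. Trudinger, *Elliptic Partial Differential Equations of Second Order* (2001),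
  Thm. 6.2, §17.4 (17.43). [GilbargTrudinger2001]
-/

noncomputable section

set_option maxSynthPendingDepth 3

open scoped Manifold ContDiff Topology
open Set Filter Metric Function Module

namespace Literature.Geometry.Riemannian.GurskyViaclovskyPath

open Literature.Geometry.Lorentzian (PseudoRiemannianMetric)
open Literature.Geometry.Lorentzian.PseudoRiemannianMetric
open Literature.Geometry.Lorentzian
open Literature.Geometry.Lorentzian.MetricCoord
open Literature.Analysis.Calculus Literature.Analysis.PDE

/-! ### A linear functional of a `2`-jet, slot by slot -/

/-- **Expansion of a linear functional of a coordinate `2`-jet over the slots**: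
`D J = D(single₂ J₂) + Σ_l D(single₁ δ_l) J₁(l) + D(single₀ 1) J₀` (`J = Σ_j single_j J_j`, the
slot `1` expanded in the elementary covectors `δ_l`, the slot `0` one-dimensional). [folklore] -/
theorem clm_apply_cjet_two {ι : Type*} [Fintype ι] [DecidableEq ι] (D : CJet ι 2 →L[ℝ] ℝ)
    (J : CJet ι 2) :
    D J = D (Pi.single (Fin.last 2) (J (Fin.last 2))) +
      (∑ l, D (Pi.single 1 (Pi.single (fun _ => l) 1)) * J 1 (fun _ => l)) +
      D (Pi.single 0 (fun _ => 1)) * J 0 Fin.elim0 := by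
  -- the slots `0`, `1` of `CJet ι 2` are indexed by `Fin ↑(0 : Fin 3) → ι`, `Fin ↑(1 : Fin 3) → ι`
  haveI hS : Subsingleton (Fin ((0 : Fin 3) : ℕ) → ι) :=
    (inferInstance : Subsingleton (Fin 0 → ι))
  haveI hU : Unique (Fin ((1 : Fin 3) : ℕ)) := (inferInstance : Unique (Fin 1))
  have h0 : D (Pi.single 0 (J 0)) = D (Pi.single 0 (fun _ => 1)) * J 0 Fin.elim0 := by
    set D0 : ((Fin ((0 : Fin 3) : ℕ) → ι) → ℝ) →L[ℝ] ℝ := D.comp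
      (ContinuousLinearMap.single ℝ (fun j : Fin 3 => (Fin (j : ℕ) → ι) → ℝ) 0) with hD0
    have hD0a : ∀ f, D (Pi.single 0 f) = D0 f := fun f => rfl
    have hJ : J 0 = J 0 Fin.elim0 • (fun _ => (1 : ℝ)) := by
      funext I
      rw [Pi.smul_apply, smul_eq_mul, mul_one]
      exact congrArg (J 0) (Subsingleton.elim _ _)
    rw [hD0a, hD0a]
    conv_lhs => rw [hJ, map_smul]
    rw [smul_eq_mul, mul_comm]
  have h1 : D (Pi.single 1 (J 1)) =
      ∑ l, D (Pi.single 1 (Pi.single (fun _ => l) 1)) * J 1 (fun _ => l) := by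
    set D1 : ((Fin ((1 : Fin 3) : ℕ) → ι) → ℝ) →L[ℝ] ℝ := D.comp
      (ContinuousLinearMap.single ℝ (fun j : Fin 3 => (Fin (j : ℕ) → ι) → ℝ) 1) with hD1
    have hD1a : ∀ f, D (Pi.single 1 f) = D1 f := fun f => rfl
    simp only [hD1a]
    conv_lhs => rw [← Finset.univ_sum_single (J 1), map_sum]
    refine Fintype.sum_equiv (Equiv.funUnique (Fin ((1 : Fin 3) : ℕ)) ι) _ _ fun I => ?_
    obtain ⟨l, rfl⟩ : ∃ l, I = fun _ => l :=
      ⟨I default, funext fun k => congrArg I (Subsingleton.elim _ _)⟩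
    show D1 (Pi.single (fun _ => l) (J 1 fun _ => l)) =
      D1 (Pi.single (fun _ => l) 1) * J 1 fun _ => l
    rw [show Pi.single (fun _ : Fin ((1 : Fin 3) : ℕ) => l) (J 1 fun _ => l) =
        J 1 (fun _ => l) • (Pi.single (fun _ : Fin ((1 : Fin 3) : ℕ) => l) (1 : ℝ) :
          (Fin ((1 : Fin 3) : ℕ) → ι) → ℝ) by
      rw [← Pi.single_smul', smul_eq_mul, mul_one], map_smul, smul_eq_mul, mul_comm]
  have h2 : D (Pi.single 2 (J 2)) = D (Pi.single (Fin.last 2) (J (Fin.last 2))) := rfl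
  conv_lhs => rw [← Finset.univ_sum_single J, map_sum]
  rw [Fin.sum_univ_three, h0, h1, h2]
  ring

/-! ### The linearised operator in the preferred chart -/

section ManifoldChart

variable {M : Type*} [TopologicalSpace M] [ChartedSpace (EuclideanSpace ℝ (Fin 4)) M]
  [IsManifold (𝓡 4) ∞ M]
  (g : PseudoRiemannianMetric (𝓡 4) ∞ (EuclideanSpace ℝ (Fin 4)) (TangentSpace (𝓡 4) : M → Type _))
  [g.HasLeviCivita]

set_option maxHeartbeats 800000 in
-- one long proof: chart transport, two derivative computations and the slot expansion
/-- **The linearised weighted `σ₂` path operator in a chart** (Gursky–Viaclovsky 2003, proof of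
Prop. 2: "`𝓛^t(φ) = d/ds F_t[x, u_s, ∇u_s, ∇²u_s]|_{s=0} = L^t(g⁻¹A^t_u)_{ij}(g⁻¹∇²φ)_{ij} − 4f²e^{4u}φ
+ ⋯`. For `t ≤ 1`, `L^t(g⁻¹A^t_u)` is positive definite, so `𝓛^t` is elliptic"). Let `g` be
Riemannian with Levi-Civita connection on a `4`-manifold, `q > 0` and `w` smooth with
`backgroundPathOperator g t w = q e^{−4w}`, `backgroundScalar g w > 0`, `t ≤ 1`, and `c ∈ M`.
There are coefficients `a^{ii'}, bˡ, c₀`, smooth on the target of the preferred chart at `c`,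
`a` symmetric and positive definite at every point of the target, such that for every
`u ∈ C²(M)` and `y` in the target, with `x = (chartAt c)⁻¹ y`, `û = u ∘ (chartAt c)⁻¹` and the
standard frame `e` of `ℝ⁴`:
`−(𝓛_{t,w}u(x) + 4q(x)e^{−4w(x)}u(x)) = Σ a^{ii'}(y) D²û(y)(e_i,e_{i'}) + Σ bˡ(y) Dû(y)(e_l) + c₀(y)û(y)`.
(Chart equation along `s ↦ w + su`, `hasDerivAt_backgroundPathOperator`, uniqueness of
derivatives, expansion of the jet derivative of the smooth jet function over the slots;
positivity from `le_fderiv_jetOperator_single` and `symCoef_lower`.)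
[cite: GurskyViaclovsky2003, §2, proof of Prop. 2] -/
theorem exists_linearised_chartRep (hg : g.IsRiemannian) {q : M → ℝ}
    (hq : ContMDiff (𝓡 4) 𝓘(ℝ) ∞ q) (hq0 : ∀ x, 0 < q x) {t : ℝ} (ht : t ≤ 1) {w : M → ℝ}
    (hw : ContMDiff (𝓡 4) 𝓘(ℝ) ∞ w) (hpos : ∀ x, 0 < backgroundScalar g w x)
    (heq : ∀ x, backgroundPathOperator g t w x = q x * Real.exp (-4 * w x)) (c : M) :
    ∃ (a : Fin 4 → Fin 4 → EuclideanSpace ℝ (Fin 4) → ℝ)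
      (b : Fin 4 → EuclideanSpace ℝ (Fin 4) → ℝ) (c₀ : EuclideanSpace ℝ (Fin 4) → ℝ),
      (∀ i i', ContDiffOn ℝ ∞ (a i i') (chartAt (EuclideanSpace ℝ (Fin 4)) c).target) ∧
      (∀ l, ContDiffOn ℝ ∞ (b l) (chartAt (EuclideanSpace ℝ (Fin 4)) c).target) ∧
      ContDiffOn ℝ ∞ c₀ (chartAt (EuclideanSpace ℝ (Fin 4)) c).target ∧
      (∀ i i' y, a i i' y = a i' i y) ∧
      (∀ y ∈ (chartAt (EuclideanSpace ℝ (Fin 4)) c).target, ∀ ξ : Fin 4 → ℝ, ξ ≠ 0 →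
        0 < ∑ i, ∑ i', a i i' y * ξ i * ξ i') ∧
      ∀ (u : M → ℝ), ContMDiff (𝓡 4) 𝓘(ℝ) 2 u →
        ∀ y ∈ (chartAt (EuclideanSpace ℝ (Fin 4)) c).target,
          -(linearisedBackgroundOperator g t w u ((chartAt (EuclideanSpace ℝ (Fin 4)) c).symm y) +
              4 * q ((chartAt (EuclideanSpace ℝ (Fin 4)) c).symm y) *
                Real.exp (-4 * w ((chartAt (EuclideanSpace ℝ (Fin 4)) c).symm y)) *
                u ((chartAt (EuclideanSpace ℝ (Fin 4)) c).symm y)) =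
            (∑ i, ∑ i', a i i' y *
                iteratedFDeriv ℝ 2 (fun z => u ((chartAt (EuclideanSpace ℝ (Fin 4)) c).symm z)) y
                  ![EuclideanSpace.basisFun (Fin 4) ℝ i, EuclideanSpace.basisFun (Fin 4) ℝ i']) +
              (∑ l, b l y *
                fderiv ℝ (fun z => u ((chartAt (EuclideanSpace ℝ (Fin 4)) c).symm z)) y
                  (EuclideanSpace.basisFun (Fin 4) ℝ l)) +
              c₀ y * u ((chartAt (EuclideanSpace ℝ (Fin 4)) c).symm y) := by
  classical
  -- the inverse chart at `c` and the pulled-back metric (as in the closedness programme)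
  set U : TopologicalSpace.Opens (EuclideanSpace ℝ (Fin 4)) :=
    ⟨(chartAt (EuclideanSpace ℝ (Fin 4)) c).target,
      (chartAt (EuclideanSpace ℝ (Fin 4)) c).open_target⟩
  set Φ : U → M := fun u ↦ (chartAt (EuclideanSpace ℝ (Fin 4)) c).symm u
  have hΦ : ContMDiff 𝓘(ℝ, EuclideanSpace ℝ (Fin 4)) 𝓘(ℝ, EuclideanSpace ℝ (Fin 4)) (∞ + 1) Φ :=
    ChartInverseSelf.contMDiff_symm c
  have hΦ' : ∀ u, Function.Injective
      (mfderiv 𝓘(ℝ, EuclideanSpace ℝ (Fin 4)) 𝓘(ℝ, EuclideanSpace ℝ (Fin 4)) Φ u) :=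
    ChartInverseSelf.injective_mfderiv_symm c
  have hdim : Module.finrank ℝ (EuclideanSpace ℝ (Fin 4)) =
      Module.finrank ℝ (EuclideanSpace ℝ (Fin 4)) := rfl
  have hE : finrank ℝ (EuclideanSpace ℝ (Fin 4)) = 4 := finrank_euclideanSpace_fin
  have hn : (2 : ℕ∞ω) ≤ ((⊤ : ℕ∞) : ℕ∞ω) := WithTop.coe_le_coe.mpr le_top
  have h2top : (2 : WithTop ℕ∞) ≤ ∞ := WithTop.coe_le_coe.mpr le_top
  have hpb : contMDiff_pullbackBilin 𝓘(ℝ, EuclideanSpace ℝ (Fin 4)) M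
      𝓘(ℝ, EuclideanSpace ℝ (Fin 4)) U ∞ := contMDiff_pullbackBilin_holds
  set gU := g.comap hpb Φ hΦ hΦ' hdim
  haveI : gU.HasLeviCivita := gU.hasLeviCivita
  set G : EuclideanSpace ℝ (Fin 4) →
      EuclideanSpace ℝ (Fin 4) →L[ℝ] EuclideanSpace ℝ (Fin 4) →L[ℝ] ℝ :=
    Function.extend (Subtype.val : U → EuclideanSpace ℝ (Fin 4))
      (fun y : U ↦ (gU.val y :
        EuclideanSpace ℝ (Fin 4) →L[ℝ] EuclideanSpace ℝ (Fin 4) →L[ℝ] ℝ)) (fun _ ↦ 0) with hGdef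
  have hG : ∀ y : U, gU.val y = G y := fun y ↦ by
    rw [hGdef, Subtype.val_injective.extend_apply]
  have hmet : IsMetricOn G (U : Set (EuclideanSpace ℝ (Fin 4))) := OpensChart.isMetricOn_repr hG
  have hgUR : gU.IsRiemannian := fun z v hv ↦ by
    have h1 : gU.val z v v = g.val (Φ z)
        (mfderiv 𝓘(ℝ, EuclideanSpace ℝ (Fin 4)) 𝓘(ℝ, EuclideanSpace ℝ (Fin 4)) Φ z v)
        (mfderiv 𝓘(ℝ, EuclideanSpace ℝ (Fin 4)) 𝓘(ℝ, EuclideanSpace ℝ (Fin 4)) Φ z v) := rfl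
    rw [h1]
    exact hg _ _ fun h0 ↦ hv ((hΦ' z) (by
      rw [h0]
      exact ((mfderiv 𝓘(ℝ, EuclideanSpace ℝ (Fin 4)) 𝓘(ℝ, EuclideanSpace ℝ (Fin 4)) Φ
        z).map_zero).symm))
  -- the Weyl weight and the right-hand side in the chart
  set W : EuclideanSpace ℝ (Fin 4) → ℝ :=
    fun z ↦ g.weylNormSq ((chartAt (EuclideanSpace ℝ (Fin 4)) c).symm z) with hWdef
  have hWy : ∀ y : U, W y = gU.weylNormSq y := fun y ↦
    (g.weylNormSq_comap hpb hΦ hΦ' hdim hg y).symm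
  have hW : ContDiffOn ℝ ∞ W (U : Set (EuclideanSpace ℝ (Fin 4))) :=
    contDiffOn_of_eq_weylNormSq gU hG hgUR hWy
  set Q : EuclideanSpace ℝ (Fin 4) → ℝ :=
    fun z ↦ q ((chartAt (EuclideanSpace ℝ (Fin 4)) c).symm z) with hQdef
  have hQ : ContDiffOn ℝ ∞ Q (U : Set (EuclideanSpace ℝ (Fin 4))) := fun z hz ↦
    (ChartInverseSelf.contDiffAt_comp_symm c hq hz).contDiffWithinAt
  -- the frame and the jet function of the closedness programme
  set bE : OrthonormalBasis (Fin 4) ℝ (EuclideanSpace ℝ (Fin 4)) :=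
    EuclideanSpace.basisFun (Fin 4) ℝ with hbE
  set Jf : EuclideanSpace ℝ (Fin 4) × ℝ × CJet (Fin 4) 2 → ℝ := fun x ↦
    chartOperator G x.2.1 (W x.1) x.1 (pOf bE x.2.2) (rOf bE x.2.2) -
      Q x.1 * Real.exp (4 * x.2.2 0 Fin.elim0) with hJf
  have hJfs : ContDiffOn ℝ ∞ Jf {x | x.1 ∈ (chartAt (EuclideanSpace ℝ (Fin 4)) c).target} :=
    contDiffOn_jetOperator bE hmet hW hQ
  have hopen : IsOpen {x : EuclideanSpace ℝ (Fin 4) × ℝ × CJet (Fin 4) 2 |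
      x.1 ∈ (chartAt (EuclideanSpace ℝ (Fin 4)) c).target} :=
    (chartAt (EuclideanSpace ℝ (Fin 4)) c).open_target.preimage continuous_fst
  -- the solution in the `u = -w` convention of the closedness programme, its representative
  set u₀ : M → ℝ := fun m ↦ -w m with hu₀
  have hu₀s : ContMDiff (𝓡 4) 𝓘(ℝ) ∞ u₀ := hw.neg
  set F : EuclideanSpace ℝ (Fin 4) → ℝ :=
    fun z ↦ u₀ ((chartAt (EuclideanSpace ℝ (Fin 4)) c).symm z) with hF
  have hFs : ContDiffOn ℝ ∞ F (chartAt (EuclideanSpace ℝ (Fin 4)) c).target := fun z hz ↦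
    (ChartInverseSelf.contDiffAt_comp_symm c hu₀s hz).contDiffWithinAt
  set J₀ : EuclideanSpace ℝ (Fin 4) → CJet (Fin 4) 2 := fun y ↦ cjetOf bE 2 F y with hJ₀
  have hJ₀s : ContDiffOn ℝ ∞ J₀ (chartAt (EuclideanSpace ℝ (Fin 4)) c).target :=
    contDiffOn_cjetOf bE 2 (chartAt (EuclideanSpace ℝ (Fin 4)) c).open_target hFs
  set γ : EuclideanSpace ℝ (Fin 4) → EuclideanSpace ℝ (Fin 4) × ℝ × CJet (Fin 4) 2 :=
    fun y ↦ (y, t, J₀ y) with hγ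
  have hγs : ContDiffOn ℝ ∞ γ (chartAt (EuclideanSpace ℝ (Fin 4)) c).target :=
    contDiffOn_id.prodMk (contDiffOn_const.prodMk hJ₀s)
  have hγm : MapsTo γ (chartAt (EuclideanSpace ℝ (Fin 4)) c).target
      {x | x.1 ∈ (chartAt (EuclideanSpace ℝ (Fin 4)) c).target} := fun y hy ↦ hy
  have hDJ : ContDiffOn ℝ ∞ (fun y ↦ fderiv ℝ Jf (γ y))
      (chartAt (EuclideanSpace ℝ (Fin 4)) c).target :=
    (hJfs.fderiv_of_isOpen hopen (le_of_eq rfl)).comp hγs hγm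
  -- the coefficients
  refine ⟨fun i i' y ↦ symCoef Jf i i' (γ y),
    fun l y ↦ fderiv ℝ Jf (γ y) ((0 : EuclideanSpace ℝ (Fin 4)), (0 : ℝ),
      Pi.single (1 : Fin 3) (Pi.single (fun _ ↦ l) (1 : ℝ))),
    fun y ↦ fderiv ℝ Jf (γ y) ((0 : EuclideanSpace ℝ (Fin 4)), (0 : ℝ),
      Pi.single (0 : Fin 3) (fun _ ↦ (1 : ℝ))),
    fun i i' ↦ (contDiffOn_symCoef (chartAt (EuclideanSpace ℝ (Fin 4)) c).open_target hJfs i i').comp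
      hγs hγm,
    fun l ↦ hDJ.clm_apply contDiffOn_const, hDJ.clm_apply contDiffOn_const,
    fun i i' y ↦ symCoef_comm Jf i i' (γ y), fun y hy ξ hξ ↦ ?_, fun u hu y hy ↦ ?_⟩
  · /- pointwise ellipticity: the jet function is elliptic along the admissible solution
    (`le_fderiv_jetOperator_single`, all constants evaluated at the point `y`) -/
    set y' : U := ⟨y, hy⟩ with hy'
    have hf : ContMDiff 𝓘(ℝ, EuclideanSpace ℝ (Fin 4)) 𝓘(ℝ) ∞ (u₀ ∘ Φ) :=
      hu₀s.comp (hΦ.of_le le_self_add)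
    have hfF : ∀ z : U, (u₀ ∘ Φ) z = F z := fun _ ↦ rfl
    have hF2 : ContDiffAt ℝ 2 F y := (ChartInverseSelf.contDiffAt_comp_symm c hu₀s hy).of_le h2top
    have heq0 : ∀ x, backgroundPathOperator g t (fun m ↦ -u₀ m) x =
        q x * Real.exp (-4 * (-u₀ x)) := fun x ↦ by
      simp only [hu₀, neg_neg]
      exact heq x
    have hpos0 : ∀ x, 0 < backgroundScalar g (fun m ↦ -u₀ m) x := fun x ↦ by
      simp only [hu₀, neg_neg]
      exact hpos x
    have heqU : backgroundPathOperator gU t (fun z ↦ -(u₀ ∘ Φ) z) y' =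
        (fun z : U ↦ Q z) y' * Real.exp (-4 * (-(u₀ ∘ Φ) y')) :=
      (backgroundPathOperator_comap g hpb hΦ hΦ' hdim hg (w := fun m ↦ -u₀ m) hu₀s.neg t y').trans
        (heq0 (Φ y'))
    have hposU : 0 < backgroundScalar gU (fun z ↦ -(u₀ ∘ Φ) z) y' := by
      have h := backgroundScalar_comap g hpb hΦ hΦ' hdim hg (w := fun m ↦ -u₀ m) hu₀s.neg y'
      exact (hpos0 (Φ y')).trans_eq h.symm
    -- the constants of the ellipticity lemma, at the point
    set C : ℝ := max (max |(u₀ ∘ Φ) y'| (gU.gradSq (u₀ ∘ Φ) y'))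
      (gU.normSq y' (gU.hessian (u₀ ∘ Φ) y')) with hC
    have hC0 : 0 ≤ C := (abs_nonneg _).trans ((le_max_left _ _).trans (le_max_left _ _))
    set P : ℝ := Real.sqrt |gU.normSq y' (gU.ricci y')| + |gU.scalarCurvature y'| with hP
    have hP0 : 0 ≤ P := by positivity
    have hRic : gU.normSq y' (gU.ricci y') ≤ P ^ 2 :=
      calc gU.normSq y' (gU.ricci y') ≤ |gU.normSq y' (gU.ricci y')| := le_abs_self _
        _ = Real.sqrt |gU.normSq y' (gU.ricci y')| ^ 2 := (Real.sq_sqrt (abs_nonneg _)).symm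
        _ ≤ P ^ 2 :=
          pow_le_pow_left₀ (Real.sqrt_nonneg _) (le_add_of_nonneg_right (abs_nonneg _)) 2
    have hR : |gU.scalarCurvature y'| ≤ P := le_add_of_nonneg_left (Real.sqrt_nonneg _)
    obtain ⟨fr, hfr⟩ :=
      gU.exists_basis_isOrthonormalFrame (x := y') (fun v hv ↦ hgUR y' v hv) hE
    set κ : ℝ := 1 + ∑ a, @norm (EuclideanSpace ℝ (Fin 4)) _ (fr a) with hκ
    have hsum0 : 0 ≤ ∑ a, @norm (EuclideanSpace ℝ (Fin 4)) _ (fr a) :=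
      Finset.sum_nonneg fun a _ ↦ norm_nonneg _
    have hκ0 : 0 < κ := by positivity
    have hκa : ∀ a, @norm (EuclideanSpace ℝ (Fin 4)) _ (fr a) ≤ κ := fun a ↦
      le_add_of_nonneg_of_le zero_le_one
        (Finset.single_le_sum (f := fun a ↦ @norm (EuclideanSpace ℝ (Fin 4)) _ (fr a))
          (fun _ _ ↦ norm_nonneg _) (Finset.mem_univ a))
    set Λg : ℝ := 1 + ‖G y‖ with hΛg
    have hΛg0 : 0 < Λg := by positivity
    have hΛgy : ‖G y‖ ≤ Λg := le_add_of_nonneg_left zero_le_one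
    have hq₀ : 0 < Q y := hq0 _
    set lam : ℝ := 4 * (Q y * Real.exp (-4 * C) / 4 /
        (2 * (4 * ((1 + |t|) * P + (3 + 2 * |t|) * Real.sqrt C + (5 + 2 * |t|) * C) + 1))) /
      ((Λg * κ) ^ 2 * 4) with hlam
    have hlam0 : 0 < lam := by positivity
    have hell : ∀ η : EuclideanSpace ℝ (Fin 4) →L[ℝ] ℝ, lam * ‖η‖ ^ 2 ≤
        fderiv ℝ Jf (γ y) ((0 : EuclideanSpace ℝ (Fin 4)), (0 : ℝ),
          Pi.single (Fin.last 2) (fun I : Fin 2 → Fin 4 ↦ η (bE (I 0)) * η (bE (I 1)))) :=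
      fun η ↦ le_fderiv_jetOperator_single gU hG hgUR bE hW hQ hf hfF (q := fun z : U ↦ Q z) ht
        le_rfl hq₀ hC0 hP0 y' hF2 le_rfl heqU hposU ((le_max_left _ _).trans (le_max_left _ _))
        ((le_max_right _ _).trans (le_max_left _ _)) (le_max_right _ _) hRic hR hfr hκ0.le hκa
        hΛgy η
    have hlow := symCoef_lower bE Jf (γ y) (l := lam)
      (fun η ↦ by rw [topSym_apply]; exact hell η) ξ
    have hξ2 : 0 < ∑ a, ξ a ^ 2 := by
      obtain ⟨i, hi⟩ := Function.ne_iff.1 hξ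
      exact Finset.sum_pos' (fun a _ ↦ sq_nonneg _) ⟨i, Finset.mem_univ _, sq_pos_iff.mpr hi⟩
    exact (mul_pos hlam0 hξ2).trans_le hlow
  · /- the representation: differentiate the chart equation along `s ↦ w + s u` at `s = 0` -/
    set û : EuclideanSpace ℝ (Fin 4) → ℝ :=
      fun z ↦ u ((chartAt (EuclideanSpace ℝ (Fin 4)) c).symm z) with hû
    set ŵ : EuclideanSpace ℝ (Fin 4) → ℝ :=
      fun z ↦ w ((chartAt (EuclideanSpace ℝ (Fin 4)) c).symm z) with hŵ
    have hŵs : ContDiffAt ℝ ∞ ŵ y := ChartInverseSelf.contDiffAt_comp_symm c hw hy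
    have hw2 : ContMDiffAt (𝓡 4) 𝓘(ℝ) 2 w ((chartAt (EuclideanSpace ℝ (Fin 4)) c).symm y) :=
      (hw.of_le hn) _
    have hu2 : ContMDiffAt (𝓡 4) 𝓘(ℝ) 2 u ((chartAt (EuclideanSpace ℝ (Fin 4)) c).symm y) := hu _
    have hû2 : ContDiffAt ℝ 2 û y := contDiffAt_comp_chart_symm_of_contMDiffAt c hy hu2
    set J₁ : CJet (Fin 4) 2 := cjetOf bE 2 û y with hJ₁
    set v : EuclideanSpace ℝ (Fin 4) × ℝ × CJet (Fin 4) 2 :=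
      ((0 : EuclideanSpace ℝ (Fin 4)), (0 : ℝ), -J₁) with hv
    -- (1) the coordinate jet along the line is affine in `s`
    have R1 : ∀ s : ℝ, cjetOf bE 2 (fun z ↦ -(w ((chartAt (EuclideanSpace ℝ (Fin 4)) c).symm z) +
        s * u ((chartAt (EuclideanSpace ℝ (Fin 4)) c).symm z))) y = J₀ y - s • J₁ := by
      intro s
      have hfun : (fun z ↦ -(w ((chartAt (EuclideanSpace ℝ (Fin 4)) c).symm z) +
          s * u ((chartAt (EuclideanSpace ℝ (Fin 4)) c).symm z))) = -(ŵ + s • û) := rfl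
      have hF' : F = -ŵ := rfl
      funext j I
      have hj : ((j : ℕ) : WithTop ℕ∞) ≤ 2 := by exact_mod_cast Fin.is_le j
      have hŵj : ContDiffAt ℝ (j : ℕ) ŵ y := hŵs.of_le (WithTop.coe_le_coe.mpr le_top)
      have hûj : ContDiffAt ℝ (j : ℕ) û y := hû2.of_le hj
      rw [Pi.sub_apply, Pi.smul_apply, Pi.sub_apply, Pi.smul_apply, smul_eq_mul]
      simp only [hJ₀, hJ₁, cjetOf_apply]
      rw [hfun, hF', iteratedFDeriv_neg_apply, iteratedFDeriv_neg_apply,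
        iteratedFDeriv_add_apply hŵj (show ContDiffAt ℝ (j : ℕ) (s • û) y from hûj.const_smul s),
        iteratedFDeriv_const_smul_apply hûj]
      simp only [neg_apply, add_apply, smul_apply, smul_eq_mul]
      ring
    -- (2) the chart equation along the line
    have R2 : ∀ s : ℝ, Jf (γ y + s • v) =
        backgroundPathOperator g t (fun m ↦ w m + s * u m)
            ((chartAt (EuclideanSpace ℝ (Fin 4)) c).symm y) -
          q ((chartAt (EuclideanSpace ℝ (Fin 4)) c).symm y) *
            Real.exp (-4 * (w ((chartAt (EuclideanSpace ℝ (Fin 4)) c).symm y) +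
              s * u ((chartAt (EuclideanSpace ℝ (Fin 4)) c).symm y))) := by
      intro s
      have hus : ContMDiffAt (𝓡 4) 𝓘(ℝ) 2 (fun m ↦ -(w m + s * u m))
          ((chartAt (EuclideanSpace ℝ (Fin 4)) c).symm y) := by
        exact (hw2.add (contMDiffAt_const.mul hu2)).neg
      have h1 := backgroundPathOperator_chart_eq_chartOperator_of_contMDiffAt_two g hg t c hy hus
      simp only [neg_neg] at h1
      have hFs2 : ContDiffAt ℝ 2 (fun z ↦ -(w ((chartAt (EuclideanSpace ℝ (Fin 4)) c).symm z) +
          s * u ((chartAt (EuclideanSpace ℝ (Fin 4)) c).symm z))) y :=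
        contDiffAt_comp_chart_symm_of_contMDiffAt c hy hus
      have hline : γ y + s • v = (y, t, cjetOf bE 2 (fun z ↦
          -(w ((chartAt (EuclideanSpace ℝ (Fin 4)) c).symm z) +
            s * u ((chartAt (EuclideanSpace ℝ (Fin 4)) c).symm z))) y) := by
        rw [R1 s, sub_eq_add_neg, ← smul_neg]
        simp only [hγ, hv, Prod.smul_mk, smul_zero, Prod.mk_add_mk, add_zero]
      rw [hline]
      show chartOperator G t (W y) y (pOf bE (cjetOf bE 2 _ y)) (rOf bE (cjetOf bE 2 _ y)) -
        Q y * Real.exp (4 * cjetOf bE 2 _ y 0 Fin.elim0) = _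
      rw [pOf_cjetOf, rOf_cjetOf bE hFs2, cjetOf_zero, h1]
      have e4 : (4 : ℝ) * -(w ((chartAt (EuclideanSpace ℝ (Fin 4)) c).symm y) +
          s * u ((chartAt (EuclideanSpace ℝ (Fin 4)) c).symm y)) =
          -4 * (w ((chartAt (EuclideanSpace ℝ (Fin 4)) c).symm y) +
            s * u ((chartAt (EuclideanSpace ℝ (Fin 4)) c).symm y)) := by ring
      rw [e4]
    -- (3) differentiate both sides at `s = 0`
    have hdJ : DifferentiableAt ℝ Jf (γ y) :=
      (hJfs.differentiableOn (by simp)).differentiableAt (hopen.mem_nhds hy)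
    have hℓ : HasDerivAt (fun s : ℝ ↦ γ y + s • v) v 0 := by
      simpa using ((hasDerivAt_id (0 : ℝ)).smul_const v).const_add (γ y)
    have hd1 : HasDerivAt (fun s : ℝ ↦ Jf (γ y + s • v)) (fderiv ℝ Jf (γ y) v) 0 :=
      hdJ.hasFDerivAt.comp_hasDerivAt_of_eq (0 : ℝ) hℓ (by simp)
    have hpt : HasDerivAt (fun s : ℝ ↦
        backgroundPathOperator g t (fun m ↦ w m + s * u m)
            ((chartAt (EuclideanSpace ℝ (Fin 4)) c).symm y) -
          q ((chartAt (EuclideanSpace ℝ (Fin 4)) c).symm y) *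
            Real.exp (-4 * (w ((chartAt (EuclideanSpace ℝ (Fin 4)) c).symm y) +
              s * u ((chartAt (EuclideanSpace ℝ (Fin 4)) c).symm y))))
        (linearisedBackgroundOperator g t w u ((chartAt (EuclideanSpace ℝ (Fin 4)) c).symm y) -
          q ((chartAt (EuclideanSpace ℝ (Fin 4)) c).symm y) *
            (Real.exp (-4 * (w ((chartAt (EuclideanSpace ℝ (Fin 4)) c).symm y) +
              0 * u ((chartAt (EuclideanSpace ℝ (Fin 4)) c).symm y))) *
              (-4 * u ((chartAt (EuclideanSpace ℝ (Fin 4)) c).symm y)))) 0 := by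
      refine (hasDerivAt_backgroundPathOperator g hw2 hu2 t).sub ?_
      have h1 : HasDerivAt (fun s : ℝ ↦ -4 * (w ((chartAt (EuclideanSpace ℝ (Fin 4)) c).symm y) +
          s * u ((chartAt (EuclideanSpace ℝ (Fin 4)) c).symm y)))
          (-4 * u ((chartAt (EuclideanSpace ℝ (Fin 4)) c).symm y)) 0 := by
        simpa using (((hasDerivAt_id (0 : ℝ)).mul_const
          (u ((chartAt (EuclideanSpace ℝ (Fin 4)) c).symm y))).const_add
          (w ((chartAt (EuclideanSpace ℝ (Fin 4)) c).symm y))).const_mul (-4 : ℝ)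
      exact (h1.exp).const_mul _
    rw [show (fun s : ℝ ↦ Jf (γ y + s • v)) = _ from funext R2] at hd1
    have huniq := hd1.unique hpt
    have hneg : fderiv ℝ Jf (γ y) ((0 : EuclideanSpace ℝ (Fin 4)), (0 : ℝ), J₁) =
        -(fderiv ℝ Jf (γ y) v) := by
      rw [← map_neg]
      simp only [hv, Prod.neg_mk, neg_zero, neg_neg]
    -- (4) expand the jet derivative over the slots
    set D : CJet (Fin 4) 2 →L[ℝ] ℝ := (fderiv ℝ Jf (γ y)).comp
      ((ContinuousLinearMap.inr ℝ (EuclideanSpace ℝ (Fin 4)) (ℝ × CJet (Fin 4) 2)).comp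
        (ContinuousLinearMap.inr ℝ ℝ (CJet (Fin 4) 2))) with hD
    have hDa : ∀ K, D K = fderiv ℝ Jf (γ y) ((0 : EuclideanSpace ℝ (Fin 4)), (0 : ℝ), K) :=
      fun K ↦ rfl
    have hJ2 : J₁ (Fin.last 2) =
        fun I : Fin 2 → Fin 4 ↦ iteratedFDeriv ℝ 2 û y ![bE (I 0), bE (I 1)] := by
      funext I
      show iteratedFDeriv ℝ 2 û y (fun k ↦ bE (I k)) = _
      congr 1
      funext k
      fin_cases k <;> rfl
    have hsym : ∀ a b', iteratedFDeriv ℝ 2 û y ![bE a, bE b'] =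
        iteratedFDeriv ℝ 2 û y ![bE b', bE a] := fun a b' ↦ by
      rw [iteratedFDeriv_two_apply, iteratedFDeriv_two_apply]
      simp only [Matrix.cons_val_zero, Matrix.cons_val_one]
      exact (hû2.isSymmSndFDerivAt (by
        simp only [minSmoothness_of_isRCLikeNormedField]
        exact le_rfl)).eq _ _
    have hJ1 : ∀ l, J₁ 1 (fun _ ↦ l) = fderiv ℝ û y (bE l) := fun l ↦
      iteratedFDeriv_one_apply (𝕜 := ℝ) (f := û) (x := y) (fun _ ↦ bE l)
    have hJ0 : J₁ 0 Fin.elim0 = û y := cjetOf_zero bE 2 û y _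
    have htop : D (Pi.single (Fin.last 2) (J₁ (Fin.last 2))) =
        ∑ i, ∑ i', symCoef Jf i i' (γ y) * iteratedFDeriv ℝ 2 û y ![bE i, bE i'] := by
      rw [hJ2, hDa, sum_symCoef_mul Jf (γ y) hsym, topSym_apply]
    calc -(linearisedBackgroundOperator g t w u ((chartAt (EuclideanSpace ℝ (Fin 4)) c).symm y) +
          4 * q ((chartAt (EuclideanSpace ℝ (Fin 4)) c).symm y) *
            Real.exp (-4 * w ((chartAt (EuclideanSpace ℝ (Fin 4)) c).symm y)) *
            u ((chartAt (EuclideanSpace ℝ (Fin 4)) c).symm y))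
        = fderiv ℝ Jf (γ y) ((0 : EuclideanSpace ℝ (Fin 4)), (0 : ℝ), J₁) := by
          rw [hneg, huniq]
          simp only [zero_mul, add_zero]
          ring
      _ = D J₁ := (hDa J₁).symm
      _ = _ := by
          rw [clm_apply_cjet_two D J₁, htop, hDa, hJ0]
          simp only [hDa, hJ1]
          rfl

end ManifoldChart

end Literature.Geometry.Riemannian.GurskyViaclovskyPath

end
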